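import Summits.CriticalPhenomena.PercolationContinuityZ3.Theorems.PercAnnulusCrossingIICMultiPointPadding
import Summits.CriticalPhenomena.PercolationContinuityZ3.Theorems.PercAnnulusCrossingIICTwoPointSandwich
import HarnessLib

/-!
# Mixed moments of the shell volumes of Kesten's IIC factorise: `E_ν[∏_i V_{R_i}] ≤ A·K^k·∏_i E_ν[V_{R_i}]` (lane RSW3, p1 gen 19)

builds on p205010 (kernel theorem, internal audit signed; external expert review pending) — NOT used in this file (only `p_c(ℤ^d) > 0`).

RSW3 lane (LANE 3 `prim-rsw3`), seat `prim-rsw3-p1` (gen 19).  Helper file (`--supports stmt-CriticalPhenomena-4575`);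
no definitions, no sorries.  Memo `run/shared/lean/prim/rsw3/P1-QM.md` §32.

Gen 19 (11) proved `E_ν[V_R V_{R'}] ≤ K E_ν[V_R] E_ν[V_{R'}]` for two separated shells.  With the k-point factorisation for finitely many
sites (gen 19 (13), `exists_iicMeasure_real_biInter_openConn_two_sided_fin`) the same holds for ALL mixed moments:

* `integral_prod_card_filter_eq_sum` — `∫ ∏_{i<k} #{x ∈ S_i : ω ∈ A_i(x)} dμ = Σ_{q ∈ ∏_i S_i} μ(⋂_i A_i(q_i))` (any finite measure);
  `integral_card_filter_eq_sum` — `∫ #{x ∈ S : ω ∈ A_x} dμ = Σ_{x∈S} μ(A_x)`;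
* `biInter_range_eq_iInter_fin` — bookkeeping `⋂_{j<k} f(j) = ⋂_{i : Fin k} f(i)`;
* **`exists_integral_prod_shellVolume_le_criticalProbI`** — (A2)□(s,L) + `CU⁺_l` + UAD at `p_c(ℤ^d)`, `d ≥ 2`: there are `ρ', R₀ ≥ 1` and `A, K > 0`
  such that for every IIC measure `ν`, every `k ≥ 1` and all radii `R_0, …, R_{k−1}` with `R_0 ≥ R₀` and `ρ'·R_i ≤ R_{i+1}`, with
  `V_i = |C(0) ∩ (Λ(2R_i) ∖ Λ(R_i))|`: **`E_ν[∏_{i<k} V_i] ≤ A·K^k·∏_{i<k} E_ν[V_i]`** — ALL MIXED MOMENTS OF THE SHELL VOLUMES AT SEPARATED SCALES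
  FACTORISE UP TO `K^k` (quasi-independence of the IIC across scales at the level of volumes);
* **`exists_integral_prod_shellVolume_ge_criticalProbI`** — the matching LOWER bound **`κ^k·∏_{i<k} E_ν[V_i]·ν(univ) ≤ E_ν[∏_{i<k} V_i]`** (the lower
  half of the factorisation summed over the shells, and `E_ν V_i ≤ C₁ Σ_{x ∈ S_i} π(‖x‖)` by the two-point upper bound): the mixed moments are
  two-sided comparable to the products of the means.
References: H. Kesten, Probab. Theory Relat. Fields 73 (1986), Thm. (8), (3.13); A. Járai, Ann. Probab. 31 (2003), §3.
-/

noncomputable section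

namespace Summit.CriticalPhenomena.PercolationContinuityZ3.Theorems.Crossing

open MeasureTheory Filter Topology Literature.Probability.Percolation Literature.Probability.LatticeModels
open Literature.Probability.Percolation.DCT16
open Summit.CriticalPhenomena.PercolationContinuityZ3.Theorems.SurfaceTension

variable {d : ℕ}

/-! ## §1 Mixed moments of counts -/

open Classical in
/-- **`∫ ∏_i #{x ∈ S_i : ω ∈ A_i(x)} dμ = Σ_{q ∈ ∏_i S_i} μ(⋂_i A_i(q_i))`** for a finite measure, finitely many finite families of measurable events.
[cite: Kesten1986, Thm. (8), (43)] -/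
theorem integral_prod_card_filter_eq_sum {Ω ι : Type*} [MeasurableSpace Ω] (μ : Measure Ω) [IsFiniteMeasure μ] {k : ℕ}
    (S : Fin k → Finset ι) (A : Fin k → ι → Set Ω) (hA : ∀ i, ∀ x ∈ S i, MeasurableSet (A i x)) :
    ∫ ω, ∏ i, ((((S i).filter fun x => ω ∈ A i x).card : ℕ) : ℝ) ∂μ =
      ∑ q ∈ Fintype.piFinset S, μ.real (⋂ i, A i (q i)) := by
  have hcard : ∀ i ω, ((((S i).filter fun x => ω ∈ A i x).card : ℕ) : ℝ) = ∑ x ∈ S i, (A i x).indicator (1 : Ω → ℝ) ω := by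
    intro i ω
    rw [Finset.card_filter]; push_cast
    refine Finset.sum_congr rfl fun x _ => ?_
    by_cases h : ω ∈ A i x <;> simp [h]
  have hprod : ∀ (q : Fin k → ι) ω, ∏ i, (A i (q i)).indicator (1 : Ω → ℝ) ω = (⋂ i, A i (q i)).indicator (1 : Ω → ℝ) ω := by
    intro q ω
    by_cases h : ω ∈ ⋂ i, A i (q i)
    · rw [Set.indicator_of_mem h, Pi.one_apply]
      exact Finset.prod_eq_one fun i _ => by rw [Set.indicator_of_mem (Set.mem_iInter.1 h i), Pi.one_apply]
    · rw [Set.indicator_of_notMem h]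
      obtain ⟨i, hi⟩ : ∃ i, ω ∉ A i (q i) := by simpa [Set.mem_iInter] using h
      exact Finset.prod_eq_zero (Finset.mem_univ i) (Set.indicator_of_notMem hi _)
  have hpt : ∀ ω, ∏ i, ((((S i).filter fun x => ω ∈ A i x).card : ℕ) : ℝ) =
      ∑ q ∈ Fintype.piFinset S, (⋂ i, A i (q i)).indicator (1 : Ω → ℝ) ω := by
    intro ω
    simp_rw [hcard]
    rw [Finset.prod_univ_sum]
    exact Finset.sum_congr rfl fun q _ => hprod q ω
  have hmeas : ∀ q ∈ Fintype.piFinset S, MeasurableSet (⋂ i, A i (q i)) :=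
    fun q hq => MeasurableSet.iInter fun i => hA i _ (Fintype.mem_piFinset.1 hq i)
  have hind : ∀ E : Set Ω, MeasurableSet E → Integrable (E.indicator (1 : Ω → ℝ)) μ :=
    fun E hE => (integrable_const (1 : ℝ)).indicator hE
  simp_rw [hpt]
  rw [integral_finsetSum _ fun q hq => hind _ (hmeas q hq)]
  exact Finset.sum_congr rfl fun q hq => integral_indicator_one (hmeas q hq)

open Classical in
/-- **`∫ #{x ∈ S : ω ∈ A_x} dμ = Σ_{x ∈ S} μ(A_x)`**. [folklore] -/
theorem integral_card_filter_eq_sum {Ω ι : Type*} [MeasurableSpace Ω] (μ : Measure Ω) [IsFiniteMeasure μ]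
    (S : Finset ι) (A : ι → Set Ω) (hA : ∀ x ∈ S, MeasurableSet (A x)) :
    ∫ ω, (((S.filter fun x => ω ∈ A x).card : ℕ) : ℝ) ∂μ = ∑ x ∈ S, μ.real (A x) := by
  have hpt : ∀ ω, (((S.filter fun x => ω ∈ A x).card : ℕ) : ℝ) = ∑ x ∈ S, (A x).indicator (1 : Ω → ℝ) ω := by
    intro ω
    rw [Finset.card_filter]; push_cast
    refine Finset.sum_congr rfl fun x _ => ?_
    by_cases h : ω ∈ A x <;> simp [h]
  have hind : ∀ E : Set Ω, MeasurableSet E → Integrable (E.indicator (1 : Ω → ℝ)) μ :=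
    fun E hE => (integrable_const (1 : ℝ)).indicator hE
  simp_rw [hpt]
  rw [integral_finsetSum _ fun x hx => hind _ (hA x hx)]
  exact Finset.sum_congr rfl fun x hx => integral_indicator_one (hA x hx)

/-- `⋂_{j ∈ range k} f(j) = ⋂_{i : Fin k} f(i)`. [folklore] -/
theorem biInter_range_eq_iInter_fin {α : Type*} (k : ℕ) (f : ℕ → Set α) :
    (⋂ j ∈ Finset.range k, f j) = ⋂ i : Fin k, f i := by
  ext ω
  simp only [Set.mem_iInter, Finset.mem_range]
  exact ⟨fun h i => h i i.2, fun h j hj => h ⟨j, hj⟩⟩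

/-! ## §2 All mixed moments of the shell volumes factorise -/

open Classical in
/-- **MIXED MOMENTS OF THE SHELL VOLUMES OF KESTEN'S IIC FACTORISE** (`p_c(ℤ^d)`, `d ≥ 2`; (A2)□ at aspect `(s,L)`, `2 ≤ s ≤ L`, `ϰ > 0`;
`CU⁺_l(c_U)`, `l ≥ 2`, `c_U > 0`; UAD): there are `ρ', R₀ ≥ 1` and `A, K > 0` such that for every finite measure `ν` with Kesten's IIC limit
property, every `k ≥ 1` and all radii `R : Fin k → ℕ` with `R₀ ≤ R_0` and `ρ'·R_i ≤ R_{i+1}`, with `V_i(ω) = #{x ∈ Λ(2R_i) ∖ Λ(R_i) : 0 ↔ x}`: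
**`E_ν[∏_i V_i] ≤ A·K^k·∏_i E_ν[V_i]`**.  (Each `ν(⋂_i {0 ↔ q_i})` by the finite factorisation theorem, each `ν(0 ↔ x) ≥ c₁π(‖x‖)` by gen 18 (3).)
[cite: Kesten1986, Thm. (8)] [cite: BasuSapozhnikov2017ECP, Thm. 1.1] -/
theorem exists_integral_prod_shellVolume_le_criticalProbI (hd : 2 ≤ d) {s L : ℕ} (hs : 2 ≤ s) (hsL : s ≤ L) {ϰ : ℝ} (hϰ : 0 < ϰ)
    (hA2 : SetToSetQuasiMultAspectAt d (criticalProbI d) s L ϰ) {l : ℕ} (hl : 2 ≤ l) {cU : ℝ} (hcU : 0 < cU)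
    (hCU : ∀ a : ℕ, 1 ≤ a → ∀ E : Set (BondConfig (Site d)), IsUpperSet E → MeasurableSet E →
      cU * (bondPercolation (zdGraph d) (criticalProbI d)).real E ≤ (bondPercolation (zdGraph d) (criticalProbI d)).real (E ∩
        {ω : BondConfig (Site d) | ∀ t ∈ innerBoundary (zdGraph d) (box d a), ∀ s ∈ innerBoundary (zdGraph d) (box d (l * a)),
          ∀ t' ∈ innerBoundary (zdGraph d) (box d a), ∀ s' ∈ innerBoundary (zdGraph d) (box d (l * a)),
          ω ∈ openConnIn (↑((box d (l * a) \ box d a) ∪ innerBoundary (zdGraph d) (box d a)) : Set (Site d)) t s →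
          ω ∈ openConnIn (↑((box d (l * a) \ box d a) ∪ innerBoundary (zdGraph d) (box d a)) : Set (Site d)) t' s' →
          ω ∈ openConnIn (↑((box d (l * a) \ box d a) ∪ innerBoundary (zdGraph d) (box d a)) : Set (Site d)) s s'}))
    (hUAD : ∀ ε : ℝ, 0 < ε → ∃ K₀ : ℕ, ∀ m : ℕ, 1 ≤ m → ∀ N : ℕ, K₀ * m ≤ N →
      (bondPercolation (zdGraph d) (criticalProbI d)).real (boxCrossing d m N) ≤ ε) :
    ∃ (ρ' R₀ : ℕ) (A K : ℝ), 1 ≤ ρ' ∧ 1 ≤ R₀ ∧ 0 < A ∧ 0 < K ∧ ∀ (ν : Measure (BondConfig (Site d))) [IsFiniteMeasure ν],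
      (∀ (F : Finset (Sym2 (Site d))) (E : Set (BondConfig (Site d))), MeasurableSet E → DeterminedBy E ↑F →
        Tendsto (fun n : ℕ => (bondPercolation (zdGraph d) (criticalProbI d)).real (E ∩ siteToBoundary d n) /
          oneArmProb d (criticalProbI d) n) atTop (𝓝 (ν.real E))) →
      ∀ (k : ℕ), 1 ≤ k → ∀ (R : Fin k → ℕ), (∀ i, R₀ ≤ R i) → (∀ i j : Fin k, i.val + 1 = j.val → ρ' * R i ≤ R j) →
        ∫ ω, ∏ i : Fin k, ((((box d (2 * R i) \ box d (R i)).filter fun x =>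
            ω ∈ (openConn (0 : Site d) x : Set (BondConfig (Site d)))).card : ℕ) : ℝ) ∂ν ≤
          A * K ^ k * ∏ i : Fin k, ∫ ω, ((((box d (2 * R i) \ box d (R i)).filter fun x =>
            ω ∈ (openConn (0 : Site d) x : Set (BondConfig (Site d)))).card : ℕ) : ℝ) ∂ν := by
  obtain ⟨n₀, c₁, hn₀, hc₁, hlow⟩ := exists_le_iicMeasure_real_openConn_criticalProbI hd hs hsL hϰ hA2 hl hcU hCU hUAD
  obtain ⟨ρ, n₁, c, A, C, hρ, hn₁, -, hA, hC, hfac⟩ :=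
    exists_iicMeasure_real_biInter_openConn_two_sided_fin hd hs hsL hϰ hA2 hl hcU hCU hUAD
  refine ⟨2 * ρ, max n₀ n₁, A, C / c₁, by omega, le_trans hn₀ (le_max_left _ _), hA, by positivity, fun ν _ hν k hk R hR0 hRsep => ?_⟩
  have hmeas : ∀ w : Site d, MeasurableSet (openConn (0 : Site d) w : Set (BondConfig (Site d))) := fun w => measurableSet_openConn_holds 0 w
  set S : Fin k → Finset (Site d) := fun i => box d (2 * R i) \ box d (R i) with hS
  set π := fun m => oneArmProb d (criticalProbI d) m with hπ
  have hmem : ∀ i, ∀ x ∈ S i, R i < Site.supNorm x ∧ Site.supNorm x ≤ 2 * R i := by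
    intro i x hx
    simp only [hS, Finset.mem_sdiff, mem_box_iff_supNorm_le] at hx
    omega
  -- the mixed moment as a sum over tuples
  rw [integral_prod_card_filter_eq_sum ν S (fun _ x => (openConn (0 : Site d) x : Set (BondConfig (Site d)))) fun i x _ => hmeas x]
  -- each tuple is separated
  have htuple : ∀ q ∈ Fintype.piFinset S, ν.real (⋂ i, (openConn (0 : Site d) (q i) : Set (BondConfig (Site d)))) ≤
      A * C ^ k * ∏ i, π (Site.supNorm (q i)) := by
    intro q hq
    have hqS : ∀ i, q i ∈ S i := fun i => Fintype.mem_piFinset.1 hq i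
    set z : ℕ → Site d := fun j => if h : j < k then q ⟨j, h⟩ else 0 with hz
    have hzq : ∀ i : Fin k, z i = q i := fun i => by simp [hz, i.2]
    have hk0 : 0 < k := hk
    have hz0 : n₁ ≤ Site.supNorm (z 0) := by
      have h := (hmem ⟨0, hk0⟩ _ (hqS ⟨0, hk0⟩)).1
      have h' := hR0 ⟨0, hk0⟩
      rw [show z 0 = q ⟨0, hk0⟩ from hzq ⟨0, hk0⟩]
      have := le_max_right n₀ n₁; omega
    have hzsep : ∀ j, j + 1 < k → ρ * Site.supNorm (z j) ≤ Site.supNorm (z (j + 1)) := by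
      intro j hj
      have hj' : j < k := by omega
      rw [show z j = q ⟨j, hj'⟩ from hzq ⟨j, hj'⟩, show z (j + 1) = q ⟨j + 1, hj⟩ from hzq ⟨j + 1, hj⟩]
      have h1 := (hmem ⟨j, hj'⟩ _ (hqS ⟨j, hj'⟩)).2
      have h2 := (hmem ⟨j + 1, hj⟩ _ (hqS ⟨j + 1, hj⟩)).1
      have h3 := hRsep ⟨j, hj'⟩ ⟨j + 1, hj⟩ rfl
      calc ρ * Site.supNorm (q ⟨j, hj'⟩) ≤ ρ * (2 * R ⟨j, hj'⟩) := Nat.mul_le_mul_left _ h1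
        _ = 2 * ρ * R ⟨j, hj'⟩ := by ring
        _ ≤ R ⟨j + 1, hj⟩ := h3
        _ ≤ Site.supNorm (q ⟨j + 1, hj⟩) := h2.le
    have h := (hfac ν hν k hk z hz0 hzsep).2
    rw [biInter_range_eq_iInter_fin, Finset.prod_range (fun j => oneArmProb d (criticalProbI d) (Site.supNorm (z j)))] at h
    simp only [hzq] at h
    exact h
  -- the first moments from below
  have hfirst : ∀ i, c₁ * ∑ x ∈ S i, π (Site.supNorm x) ≤
      ∫ ω, ((((S i).filter fun x => ω ∈ (openConn (0 : Site d) x : Set (BondConfig (Site d)))).card : ℕ) : ℝ) ∂ν := by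
    intro i
    rw [integral_card_filter_eq_sum ν (S i) _ fun x _ => hmeas x, Finset.mul_sum]
    refine Finset.sum_le_sum fun x hx => hlow ν hν _ x ?_ (self_mem_sphere x)
    have h := (hmem i x hx).1; have h' := hR0 i; have := le_max_left n₀ n₁; omega
  have hπ0 : ∀ m, 0 ≤ π m := fun m => by simp only [hπ]; unfold oneArmProb; exact measureReal_nonneg
  have hsum0 : ∀ i, 0 ≤ ∑ x ∈ S i, π (Site.supNorm x) := fun i => Finset.sum_nonneg fun x _ => hπ0 _
  calc ∑ q ∈ Fintype.piFinset S, ν.real (⋂ i, (openConn (0 : Site d) (q i) : Set (BondConfig (Site d))))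
      ≤ ∑ q ∈ Fintype.piFinset S, A * C ^ k * ∏ i, π (Site.supNorm (q i)) := Finset.sum_le_sum htuple
    _ = A * C ^ k * ∏ i, ∑ x ∈ S i, π (Site.supNorm x) := by
        rw [← Finset.mul_sum, Finset.prod_univ_sum]
    _ = A * (C / c₁) ^ k * ∏ i, (c₁ * ∑ x ∈ S i, π (Site.supNorm x)) := by
        rw [Finset.prod_mul_distrib, Finset.prod_const, Finset.card_univ, Fintype.card_fin, div_pow]
        have hc0 : c₁ ^ k ≠ 0 := pow_ne_zero k hc₁.ne'
        field_simp
    _ ≤ A * (C / c₁) ^ k * ∏ i, ∫ ω, ((((S i).filter fun x => ω ∈ (openConn (0 : Site d) x : Set (BondConfig (Site d)))).card : ℕ) : ℝ) ∂ν := by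
        refine mul_le_mul_of_nonneg_left ?_ (by positivity)
        exact Finset.prod_le_prod (fun i _ => mul_nonneg hc₁.le (hsum0 i)) fun i _ => hfirst i

open Classical in
/-- **THE MATCHING LOWER BOUND ON THE MIXED MOMENTS** (`p_c(ℤ^d)`, `d ≥ 2`; (A2)□(s,L) + `CU⁺_l` + UAD): there are `ρ', R₀ ≥ 1` and `κ > 0` such that
for every finite measure `ν` with Kesten's IIC limit property, every `k ≥ 1` and all radii `R : Fin k → ℕ` with `R₀ ≤ R_0`, `ρ'·R_i ≤ R_{i+1}`:
**`κ^k · ∏_i E_ν[V_i] · ν(univ) ≤ E_ν[∏_i V_i]`** (`V_i = #{x ∈ Λ(2R_i) ∖ Λ(R_i) : 0 ↔ x}`).  With `exists_integral_prod_shellVolume_le_criticalProbI`: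
`E_ν[∏_i V_i] ≍ ∏_i E_ν[V_i]` up to `K^{±k}`. [cite: Kesten1986, Thm. (8)] -/
theorem exists_integral_prod_shellVolume_ge_criticalProbI (hd : 2 ≤ d) {s L : ℕ} (hs : 2 ≤ s) (hsL : s ≤ L) {ϰ : ℝ} (hϰ : 0 < ϰ)
    (hA2 : SetToSetQuasiMultAspectAt d (criticalProbI d) s L ϰ) {l : ℕ} (hl : 2 ≤ l) {cU : ℝ} (hcU : 0 < cU)
    (hCU : ∀ a : ℕ, 1 ≤ a → ∀ E : Set (BondConfig (Site d)), IsUpperSet E → MeasurableSet E →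
      cU * (bondPercolation (zdGraph d) (criticalProbI d)).real E ≤ (bondPercolation (zdGraph d) (criticalProbI d)).real (E ∩
        {ω : BondConfig (Site d) | ∀ t ∈ innerBoundary (zdGraph d) (box d a), ∀ s ∈ innerBoundary (zdGraph d) (box d (l * a)),
          ∀ t' ∈ innerBoundary (zdGraph d) (box d a), ∀ s' ∈ innerBoundary (zdGraph d) (box d (l * a)),
          ω ∈ openConnIn (↑((box d (l * a) \ box d a) ∪ innerBoundary (zdGraph d) (box d a)) : Set (Site d)) t s →
          ω ∈ openConnIn (↑((box d (l * a) \ box d a) ∪ innerBoundary (zdGraph d) (box d a)) : Set (Site d)) t' s' →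
          ω ∈ openConnIn (↑((box d (l * a) \ box d a) ∪ innerBoundary (zdGraph d) (box d a)) : Set (Site d)) s s'}))
    (hUAD : ∀ ε : ℝ, 0 < ε → ∃ K₀ : ℕ, ∀ m : ℕ, 1 ≤ m → ∀ N : ℕ, K₀ * m ≤ N →
      (bondPercolation (zdGraph d) (criticalProbI d)).real (boxCrossing d m N) ≤ ε) :
    ∃ (ρ' R₀ : ℕ) (κ : ℝ), 1 ≤ ρ' ∧ 1 ≤ R₀ ∧ 0 < κ ∧ ∀ (ν : Measure (BondConfig (Site d))) [IsFiniteMeasure ν],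
      (∀ (F : Finset (Sym2 (Site d))) (E : Set (BondConfig (Site d))), MeasurableSet E → DeterminedBy E ↑F →
        Tendsto (fun n : ℕ => (bondPercolation (zdGraph d) (criticalProbI d)).real (E ∩ siteToBoundary d n) /
          oneArmProb d (criticalProbI d) n) atTop (𝓝 (ν.real E))) →
      ∀ (k : ℕ), 1 ≤ k → ∀ (R : Fin k → ℕ), (∀ i, R₀ ≤ R i) → (∀ i j : Fin k, i.val + 1 = j.val → ρ' * R i ≤ R j) →
        κ ^ k * (∏ i : Fin k, ∫ ω, ((((box d (2 * R i) \ box d (R i)).filter fun x =>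
            ω ∈ (openConn (0 : Site d) x : Set (BondConfig (Site d)))).card : ℕ) : ℝ) ∂ν) * ν.real Set.univ ≤
          ∫ ω, ∏ i : Fin k, ((((box d (2 * R i) \ box d (R i)).filter fun x =>
            ω ∈ (openConn (0 : Site d) x : Set (BondConfig (Site d)))).card : ℕ) : ℝ) ∂ν := by
  obtain ⟨n₀, c₁, C₁, hn₀, hc₁, hC₁, hsand⟩ := exists_iicMeasure_real_openConn_two_sided_criticalProbI hd hs hsL hϰ hA2 hl hcU hCU hUAD
  obtain ⟨ρ, n₁, c, A, C, hρ, hn₁, hc, hA, hC, hfac⟩ :=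
    exists_iicMeasure_real_biInter_openConn_two_sided_fin hd hs hsL hϰ hA2 hl hcU hCU hUAD
  refine ⟨2 * ρ, max n₀ n₁, c / C₁, by omega, le_trans hn₀ (le_max_left _ _), by positivity, fun ν _ hν k hk R hR0 hRsep => ?_⟩
  have hmeas : ∀ w : Site d, MeasurableSet (openConn (0 : Site d) w : Set (BondConfig (Site d))) := fun w => measurableSet_openConn_holds 0 w
  set S : Fin k → Finset (Site d) := fun i => box d (2 * R i) \ box d (R i) with hS
  set π := fun m => oneArmProb d (criticalProbI d) m with hπ
  have hmem : ∀ i, ∀ x ∈ S i, R i < Site.supNorm x ∧ Site.supNorm x ≤ 2 * R i := by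
    intro i x hx
    simp only [hS, Finset.mem_sdiff, mem_box_iff_supNorm_le] at hx
    omega
  rw [integral_prod_card_filter_eq_sum ν S (fun _ x => (openConn (0 : Site d) x : Set (BondConfig (Site d)))) fun i x _ => hmeas x]
  -- each tuple is separated: lower bound by the finite factorisation theorem
  have htuple : ∀ q ∈ Fintype.piFinset S, c ^ k * (∏ i, π (Site.supNorm (q i))) * ν.real Set.univ ≤
      ν.real (⋂ i, (openConn (0 : Site d) (q i) : Set (BondConfig (Site d)))) := by
    intro q hq
    have hqS : ∀ i, q i ∈ S i := fun i => Fintype.mem_piFinset.1 hq i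
    set z : ℕ → Site d := fun j => if h : j < k then q ⟨j, h⟩ else 0 with hz
    have hzq : ∀ i : Fin k, z i = q i := fun i => by simp [hz, i.2]
    have hk0 : 0 < k := hk
    have hz0 : n₁ ≤ Site.supNorm (z 0) := by
      have h := (hmem ⟨0, hk0⟩ _ (hqS ⟨0, hk0⟩)).1
      have h' := hR0 ⟨0, hk0⟩
      rw [show z 0 = q ⟨0, hk0⟩ from hzq ⟨0, hk0⟩]
      have := le_max_right n₀ n₁; omega
    have hzsep : ∀ j, j + 1 < k → ρ * Site.supNorm (z j) ≤ Site.supNorm (z (j + 1)) := by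
      intro j hj
      have hj' : j < k := by omega
      rw [show z j = q ⟨j, hj'⟩ from hzq ⟨j, hj'⟩, show z (j + 1) = q ⟨j + 1, hj⟩ from hzq ⟨j + 1, hj⟩]
      have h1 := (hmem ⟨j, hj'⟩ _ (hqS ⟨j, hj'⟩)).2
      have h2 := (hmem ⟨j + 1, hj⟩ _ (hqS ⟨j + 1, hj⟩)).1
      have h3 := hRsep ⟨j, hj'⟩ ⟨j + 1, hj⟩ rfl
      calc ρ * Site.supNorm (q ⟨j, hj'⟩) ≤ ρ * (2 * R ⟨j, hj'⟩) := Nat.mul_le_mul_left _ h1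
        _ = 2 * ρ * R ⟨j, hj'⟩ := by ring
        _ ≤ R ⟨j + 1, hj⟩ := h3
        _ ≤ Site.supNorm (q ⟨j + 1, hj⟩) := h2.le
    have h := (hfac ν hν k hk z hz0 hzsep).1
    rw [biInter_range_eq_iInter_fin, Finset.prod_range (fun j => oneArmProb d (criticalProbI d) (Site.supNorm (z j)))] at h
    simp only [hzq] at h
    exact h
  -- the first moments from above
  have hfirst : ∀ i, ∫ ω, ((((S i).filter fun x => ω ∈ (openConn (0 : Site d) x : Set (BondConfig (Site d)))).card : ℕ) : ℝ) ∂ν ≤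
      C₁ * ∑ x ∈ S i, π (Site.supNorm x) := by
    intro i
    rw [integral_card_filter_eq_sum ν (S i) _ fun x _ => hmeas x, Finset.mul_sum]
    refine Finset.sum_le_sum fun x hx => (hsand ν hν _ x ?_ (self_mem_sphere x)).2
    have h := (hmem i x hx).1; have h' := hR0 i; have := le_max_left n₀ n₁; omega
  have hint0 : ∀ i, 0 ≤ ∫ ω, ((((S i).filter fun x => ω ∈ (openConn (0 : Site d) x : Set (BondConfig (Site d)))).card : ℕ) : ℝ) ∂ν :=
    fun i => integral_nonneg fun ω => Nat.cast_nonneg _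
  have hπ0 : ∀ m, 0 ≤ π m := fun m => by simp only [hπ]; unfold oneArmProb; exact measureReal_nonneg
  have hsum0 : ∀ i, 0 ≤ ∑ x ∈ S i, π (Site.supNorm x) := fun i => Finset.sum_nonneg fun x _ => hπ0 _
  calc (c / C₁) ^ k * (∏ i, ∫ ω, ((((S i).filter fun x => ω ∈ (openConn (0 : Site d) x : Set (BondConfig (Site d)))).card : ℕ) : ℝ) ∂ν) *
        ν.real Set.univ
      ≤ (c / C₁) ^ k * (∏ i, C₁ * ∑ x ∈ S i, π (Site.supNorm x)) * ν.real Set.univ := by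
        refine mul_le_mul_of_nonneg_right (mul_le_mul_of_nonneg_left ?_ (by positivity)) measureReal_nonneg
        exact Finset.prod_le_prod (fun i _ => hint0 i) fun i _ => hfirst i
    _ = c ^ k * (∏ i, ∑ x ∈ S i, π (Site.supNorm x)) * ν.real Set.univ := by
        rw [Finset.prod_mul_distrib, Finset.prod_const, Finset.card_univ, Fintype.card_fin, div_pow]
        have hC0 : C₁ ^ k ≠ 0 := pow_ne_zero k hC₁.ne'
        field_simp
    _ = ∑ q ∈ Fintype.piFinset S, c ^ k * (∏ i, π (Site.supNorm (q i))) * ν.real Set.univ := by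
        rw [Finset.prod_univ_sum, Finset.mul_sum, Finset.sum_mul]
    _ ≤ ∑ q ∈ Fintype.piFinset S, ν.real (⋂ i, (openConn (0 : Site d) (q i) : Set (BondConfig (Site d)))) :=
        Finset.sum_le_sum htuple

end Summit.CriticalPhenomena.PercolationContinuityZ3.Theorems.Crossing

end
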